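import Mathlib.Data.Matrix.Mul
import Mathlib.LinearAlgebra.Matrix.Notation
import Mathlib.Tactic.DeriveFintype
import Literature.Computability.Complexity.CNF
import HarnessLib

/-!
# The Tsitsiklis–Blondel pair of `0/1` matrices of a CNF

Definition request `defn-tsitsiklisBlondelPair` (route PneNP/LyapunovRefutations, items
`TBPolyhedralToLayered`, `SosLyapunovDegreeLowerBound`). Source read this session: J. N. Tsitsiklis,
V. D. Blondel, *The Lyapunov exponent and joint spectral radius of pairs of matrices are hard — when
not impossible — to compute and to approximate*, Math. Control Signals Systems 10 (1997) 31–40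
[TsitsiklisBlondel1997], §2, proof of Theorem 1, pp. 35–36, verbatim:

> "Starting from an instance of SAT with `n` variables `x₁,…,xₙ` and `m` clauses `C₁,…,C_m`, we
> construct two directed graphs `G₀` and `G₁`. […] Besides the start node `s`, there is a node `u_{ij}`
> associated to each clause `Cᵢ` and variable `xⱼ`, a `0`th node `u_{0j}` associated to each variable
> `xⱼ`, and an `(n+1)`th node `u_{i(n+1)}` associated to each clause `Cᵢ`. Edges are constructed as
> follows: for `i = 1,…,m` and `j = 1,…,n` there is an edge `(u_{ij}, u_{i(j+1)})` in both `G₀` and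
> `G₁` if the variable `xⱼ` does not appear in clause `Cᵢ`; an edge `(u_{ij}, u_{0j})` in `G₀` and an
> edge `(u_{ij}, u_{i(j+1)})` in `G₁` if the variable `xⱼ` appears in clause `Cᵢ` negatively; an edge
> `(u_{ij}, u_{0j})` in `G₁` and an edge `(u_{ij}, u_{i(j+1)})` in `G₀` if the variable `xⱼ` appears
> in clause `Cᵢ` positively. For `i = 1,…,m` there are edges `(s, u_{i1})` in both graphs. The graphs
> have edges `(u_{0j}, u_{0(j+1)})` for `j = 1,…,n-1` and have an edge from `u_{0n}` to `s`. There
> are no edges leaving from `u_{i(n+1)}`. […] `r = (n+1)(m+1)` […] `A₀` (resp. `A₁`) whose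
> `(i,j)`th entry is equal to one if there is an edge from node `j` to node `i` in `G₀` (resp. `G₁`),
> and is equal to zero otherwise."
> Observation 1 (the partition `P_{n+2} = {s}, P_{n+1} = {u_{i1}}, …, P₁ = {u_{0n}, u_{i(n+1)}}`:
> "Any edge […] leaving from a node of partition `P_h` goes to a node of partition `P_{h-1}`.
> Furthermore, the unique edge leaving from partition `P₁` goes back to partition `P_{n+2}`").
> Observation 2: "`A_{qₙ} ⋯ A_{q₁} x(u_{i1})` is equal to `x(u_{0n})` if the clause `Cᵢ` is
> satisfied and is equal to `x(u_{i(n+1)})` otherwise […] `A_ε x(u_{i(n+1)}) = 0`,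
> `A_ε x(u_{0n}) = x(s)`, and `A_ε x(s) = Σᵢ x(u_{i1})`. From this we conclude
> `A_{ε'} A_{qₙ} ⋯ A_{q₁} A_ε x(s) = λ x(s)`, where `λ` is equal to the number of clauses that are
> satisfied by the given truth assignment."

## Rendering

For `φ : Complexity.CNF ℕ` with `m := φ.length` clauses `φ[i]` and `n := φ.numVars` variables
`x₀,…,x_{n-1}` (0-indexed; every occurring variable is `< n`, `CNF.lt_numVars_of_mem_of_mem`):
* `TsitsiklisBlondel.Node m n` — `s`, `u i j` (`i : Fin m`, `j : Fin (n+1)`: TB's `u_{i,j+1}`; the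
  position `j < n` reads the variable `xⱼ`, `j = n` is the terminal node `u_{i(n+1)}`), `v j`
  (`j : Fin n`: TB's `u_{0,j+1}`); `Fintype`, `DecidableEq`, `card = (n+1)(m+1)` (PROVED).
* `next φ b x` — the unique out-neighbour in `G_b` of a node other than `s` (`none` for the
  terminal nodes): `u i j ↦ v j` if the literal `(xⱼ, b) ∈ φ[i]` (reading "`xⱼ := b` satisfies
  `Cᵢ` through `xⱼ`"), else `u i (j+1)`; `v j ↦ v (j+1)`, `v (n-1) ↦ s`. (TB assume a variable
  occurs at most once in a clause; when both `xⱼ` and `¬xⱼ` occur our graph keeps the satisfied edge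
  only, as the requester specifies.) `edge φ b x y` — the edge relation (`s → u i 0` for all `i`).
* `tbMatrix φ b : Matrix Node Node R`, `(A_b)_{y x} = 1` iff `x → y` in `G_b` (any semiring `R`),
  and **`tsitsiklisBlondelPair φ : Bool → Matrix Node Node R`**, `b ↦ A_b`.
* `layer` — TB's partition index (`s ↦ n+2`, `u i j ↦ n+1-j`, `v j ↦ n-j`); `wordProd A w` — the
  product `A_{w_{k-1}} ⋯ A_{w_0}` (first letter acts first); `SatisfiedBy φ i w` — clause `i` is
  satisfied through one of the first `|w|` variables read off the word `w`.

## Proved API (the requester's (1), (2) and the SAT half of (3))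

* (1) `layer_next` / `layer_of_edge`: every edge goes from layer `h` to layer `h - 1`, except the
  edge `v (n-1) → s` from layer `1` to layer `n + 2`; column computations `tbMatrix_mulVec_single_*`.
* (2) `wordProd_mulVec_single_u_zero` (the walk of observation 2) and **`cycle_identity`**:
  `A_{a'} · A_{w} · A_a · e_s = λ(w) · e_s` for every word `w` of length `n`, `λ(w)` the number of
  clauses satisfied by `w`.
* (3, SAT half) `cycle_identity_of_eval`: if `σ` satisfies `φ` then for `w = (σ 0, …, σ (n-1))` the
  product of the `n + 2` factors fixes `e_s` up to the factor `m` (`λ = m`).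
NOT here: the joint spectral radius and the UNSAT half of (3) (max-row-sum norm `≤ m - 1` on every
product of `n + 2` factors, TB p. 36 via observation 1 on all partitions) — left to the route items,
which quantify them themselves; `layer_of_edge` is the tool.

## References

* [TsitsiklisBlondel1997] J. N. Tsitsiklis, V. D. Blondel, MCSS 10 (1997) 31–40, §2 Thm. 1 and
  its proof (observations 1–2), pp. 35–37.
* C. H. Papadimitriou, J. N. Tsitsiklis, *The complexity of Markov decision processes*, Math. Oper.
  Res. 12 (1987), Thm. 6 (the inspiration of the construction, cited by TB).
-/

namespace Literature.Dynamics.SwitchedSystems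

open Literature.Computability.Complexity Matrix

/-! ### Nodes, edges, matrices -/

namespace TsitsiklisBlondel

/-- The nodes of the Tsitsiklis–Blondel graphs for `m` clauses and `n` variables: the start node
`s`; `u i j` = TB's `u_{i,j+1}` (`j = 0,…,n`; `j = n` is the terminal node `u_{i(n+1)}`);
`v j` = TB's `u_{0,j+1}` (`j = 0,…,n-1`). [cite: TsitsiklisBlondel1997, §2 proof of Thm. 1 (p. 35)] -/
inductive Node (m n : ℕ) : Type
  /-- The start node `s`. -/
  | s : Node m n
  /-- `u i j`: clause `i`, position `j` (TB's `u_{i,j+1}`). -/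
  | u (i : Fin m) (j : Fin (n + 1)) : Node m n
  /-- `v j`: the `0`th row node of variable `j` (TB's `u_{0,j+1}`). -/
  | v (j : Fin n) : Node m n
  deriving DecidableEq, Fintype

/-- `r = (n+1)(m+1)` nodes. [cite: TsitsiklisBlondel1997, §2 proof of Thm. 1 (p. 35)] -/
theorem card_node (m n : ℕ) : Fintype.card (Node m n) = (n + 1) * (m + 1) := by
  rw [Fintype.card_congr (show Node m n ≃ Unit ⊕ (Fin m × Fin (n + 1)) ⊕ Fin n from
      { toFun := fun x ↦ match x with
          | .s => Sum.inl ()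
          | .u i j => Sum.inr (Sum.inl (i, j))
          | .v j => Sum.inr (Sum.inr j)
        invFun := fun y ↦ match y with
          | Sum.inl _ => .s
          | Sum.inr (Sum.inl (i, j)) => .u i j
          | Sum.inr (Sum.inr j) => .v j
        left_inv := fun x ↦ by cases x <;> rfl
        right_inv := fun y ↦ by rcases y with _ | ⟨i, j⟩ | j <;> rfl })]
  simp only [Fintype.card_sum, Fintype.card_unit, Fintype.card_prod, Fintype.card_fin]
  ring

end TsitsiklisBlondel

open TsitsiklisBlondel

variable (φ : CNF ℕ)

/-- The node type of the Tsitsiklis–Blondel graphs of `φ` (`m = φ.length`, `n = φ.numVars`).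
[cite: TsitsiklisBlondel1997, §2 proof of Thm. 1 (p. 35)] -/
abbrev tbNode : Type := Node φ.length φ.numVars

/-- The unique out-neighbour in `G_b` of a node other than `s` (`none` = no out-edge, at the
terminal nodes `u i n`): from `u i j`, `j < n`, to `v j` if reading `xⱼ := b` satisfies clause `i`
through the literal `(xⱼ, b) ∈ φ[i]`, else to `u i (j+1)`; from `v j` to `v (j+1)`, and from
`v (n-1)` back to `s`. [cite: TsitsiklisBlondel1997, §2 proof of Thm. 1 (p. 35, the edge rules)] -/
def next (b : Bool) : tbNode φ → Option (tbNode φ)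
  | .s => none
  | .u i j =>
    if h : (j : ℕ) < φ.numVars then
      some (if ((j : ℕ), b) ∈ φ[i] then .v ⟨j, h⟩ else .u i ⟨j + 1, by omega⟩)
    else none
  | .v j => some (if h : (j : ℕ) + 1 < φ.numVars then .v ⟨j + 1, h⟩ else .s)

/-- The edge relation of `G_b`: `s → u i 0` for every clause `i`, and `x → next b x` otherwise.
[cite: TsitsiklisBlondel1997, §2 proof of Thm. 1 (p. 35)] -/
def edge (b : Bool) (x y : tbNode φ) : Bool :=
  match x with
  | .s => match y with
    | .u _ j => decide ((j : ℕ) = 0)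
    | _ => false
  | x => decide (next φ b x = some y)

/-- The matrix `A_b` of `G_b` over a semiring `R`: `(A_b)_{y x} = 1` if there is an edge from `x` to
`y`, `0` otherwise ("whose `(i,j)`th entry is equal to one if there is an edge from node `j` to node
`i`"). [cite: TsitsiklisBlondel1997, §2 proof of Thm. 1 (p. 36)] -/
def tbMatrix (R : Type*) [Zero R] [One R] (b : Bool) : Matrix (tbNode φ) (tbNode φ) R :=
  Matrix.of fun y x ↦ if edge φ b x y then 1 else 0

/-- **The Tsitsiklis–Blondel pair** `(A₀, A₁)` of the CNF `φ`, as a `Bool`-indexed family of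
`r × r` `0/1`-matrices, `r = (n+1)(m+1)`. [cite: TsitsiklisBlondel1997, §2 proof of Thm. 1 (pp. 35–36)] -/
def tsitsiklisBlondelPair (R : Type*) [Zero R] [One R] : Bool → Matrix (tbNode φ) (tbNode φ) R :=
  fun b ↦ tbMatrix φ R b

/-- TB's partition index: `s ∈ P_{n+2}`, `u i j ∈ P_{n+1-j}` (so `u i 0 ∈ P_{n+1}`, the terminal
`u i n ∈ P₁`), `v j ∈ P_{n-j}` (`v (n-1) ∈ P₁`). [cite: TsitsiklisBlondel1997, §2 proof of Thm. 1, observation 1] -/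
def layer : tbNode φ → ℕ
  | .s => φ.numVars + 2
  | .u _ j => φ.numVars + 1 - j
  | .v j => φ.numVars - j

variable {φ}

/-! ### (1) The layer structure -/

/-- **Observation 1**: the out-neighbour of a node of layer `h` lies in layer `h - 1`, except that
`v (n-1)` (layer `1`) goes back to `s` (layer `n+2`). [cite: TsitsiklisBlondel1997, §2 proof of Thm. 1, observation 1] -/
theorem layer_next {b : Bool} {x y : tbNode φ} (h : next φ b x = some y) :
    layer φ y + 1 = layer φ x ∨ (layer φ x = 1 ∧ y = .s) := by
  cases x with
  | s => simp [next] at h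
  | u i j =>
    simp only [next] at h
    split_ifs at h with hj hl <;> simp only [Option.some.injEq] at h <;> subst h <;>
      simp only [layer] <;> omega
  | v j =>
    simp only [next] at h
    split_ifs at h with hj <;> simp only [Option.some.injEq] at h <;> subst h <;>
      simp only [layer]
    · left; omega
    · exact Or.inr ⟨by omega, trivial⟩

/-- The same for the edge relation (edges out of `s` go from layer `n+2` to layer `n+1`).
[cite: TsitsiklisBlondel1997, §2 proof of Thm. 1, observation 1] -/
theorem layer_of_edge {b : Bool} {x y : tbNode φ} (h : edge φ b x y = true) :
    layer φ y + 1 = layer φ x ∨ (layer φ x = 1 ∧ y = .s) := by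
  cases x with
  | s =>
    cases y with
    | s => simp [edge] at h
    | u i j => simp only [edge, decide_eq_true_eq] at h; left; simp only [layer, h]; omega
    | v j => simp [edge] at h
  | u i j => exact layer_next (by simpa [edge] using h)
  | v j => exact layer_next (by simpa [edge] using h)

/-! ### Column computations -/

section Columns

variable {R : Type*} [Semiring R]

/-- The column of `x`: `A_b e_x = Σ_{x → y} e_y`, i.e. `(A_b e_x)_y = [x → y]`. [folklore] -/
theorem tbMatrix_mulVec_single (b : Bool) (x y : tbNode φ) :
    (tbMatrix φ R b *ᵥ Pi.single x 1) y = if edge φ b x y then 1 else 0 := by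
  simp [mulVec, dotProduct, tbMatrix, Pi.single_apply]

/-- A node other than `s` with out-neighbour `y` is sent to `e_y`. [cite: TsitsiklisBlondel1997, §2 proof of Thm. 1, observation 2] -/
theorem tbMatrix_mulVec_single_of_next {b : Bool} {x y : tbNode φ} (hx : x ≠ .s)
    (h : next φ b x = some y) : tbMatrix φ R b *ᵥ Pi.single x 1 = Pi.single y 1 := by
  ext z
  rw [tbMatrix_mulVec_single, Pi.single_apply]
  cases x with
  | s => exact absurd rfl hx
  | u i j =>
    have he : edge φ b (Node.u i j) z = decide (y = z) := by simp [edge, h]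
    rw [he]; by_cases hz : y = z <;> simp [hz, eq_comm]
  | v j =>
    have he : edge φ b (Node.v j) z = decide (y = z) := by simp [edge, h]
    rw [he]; by_cases hz : y = z <;> simp [hz, eq_comm]

/-- The terminal nodes are sent to `0`: `A_ε x(u_{i(n+1)}) = 0`. [cite: TsitsiklisBlondel1997, §2 proof of Thm. 1, observation 2] -/
theorem tbMatrix_mulVec_single_terminal (b : Bool) (i : Fin φ.length) :
    tbMatrix φ R b *ᵥ Pi.single (Node.u i (Fin.last φ.numVars)) 1 = 0 := by
  ext z
  rw [tbMatrix_mulVec_single]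
  simp [edge, next]

/-- The start node is sent to the sum of the first positions: `A_ε x(s) = Σᵢ x(u_{i1})`.
[cite: TsitsiklisBlondel1997, §2 proof of Thm. 1, observation 2] -/
theorem tbMatrix_mulVec_single_s (b : Bool) :
    tbMatrix φ R b *ᵥ Pi.single Node.s 1 = ∑ i : Fin φ.length, Pi.single (Node.u i 0) 1 := by
  ext z
  rw [tbMatrix_mulVec_single, Finset.sum_apply]
  cases z with
  | s => simp [edge]
  | v j => simp [edge]
  | u i j =>
    simp only [edge, Pi.single_apply, Node.u.injEq, decide_eq_true_eq]
    by_cases hj : (j : ℕ) = 0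
    · have : j = 0 := Fin.ext hj
      subst this
      simp
    · rw [if_neg hj, Finset.sum_eq_zero]
      intro k _
      rw [if_neg]
      rintro ⟨-, rfl⟩
      exact hj rfl

end Columns

/-! ### (2) Words, the walk of a clause, and the cycle identity -/

/-- The product `A_{w_{k-1}} ⋯ A_{w_1} A_{w_0}` of the matrices along the word `w = (w_0, …, w_{k-1})`
(the FIRST letter acts first on column vectors). [cite: TsitsiklisBlondel1997, §2 proof of Thm. 1, observation 2] -/
def wordProd {ι R : Type*} [Fintype ι] [DecidableEq ι] [Semiring R] (A : Bool → Matrix ι ι R)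
    (w : List Bool) : Matrix ι ι R :=
  w.foldl (fun M b ↦ A b * M) 1

section Words

variable {ι R : Type*} [Fintype ι] [DecidableEq ι] [Semiring R] (A : Bool → Matrix ι ι R)

/-- The empty word gives the identity. [folklore] -/
@[simp] theorem wordProd_nil : wordProd A [] = 1 := rfl

/-- Appending a letter multiplies on the left. [folklore] -/
theorem wordProd_append_singleton (w : List Bool) (b : Bool) :
    wordProd A (w ++ [b]) = A b * wordProd A w := by
  simp [wordProd, List.foldl_append]

/-- `wordProd (w₁ ++ w₂) = wordProd w₂-after-w₁`: concatenation composes. [folklore] -/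
theorem wordProd_append (w₁ w₂ : List Bool) :
    wordProd A (w₁ ++ w₂) = wordProd A w₂ * wordProd A w₁ := by
  induction w₂ using List.reverseRecOn with
  | nil => simp
  | append_singleton w b ih =>
    rw [← List.append_assoc, wordProd_append_singleton, ih, wordProd_append_singleton, mul_assoc]

/-- A one-letter word gives its matrix. [folklore] -/
theorem wordProd_singleton (b : Bool) : wordProd A [b] = A b := by
  simpa using wordProd_append_singleton A [] b

/-- Action on a vector, letter appended: `(A_b · W) v = A_b (W v)`. [folklore] -/
theorem wordProd_append_singleton_mulVec (w : List Bool) (b : Bool) (x : ι → R) :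
    wordProd A (w ++ [b]) *ᵥ x = A b *ᵥ (wordProd A w *ᵥ x) := by
  rw [wordProd_append_singleton, mulVec_mulVec]

end Words

variable (φ) in
/-- Clause `i` is **satisfied through one of the first `|w|` variables by the word `w`**: some
literal `(x_k, w_k)` of `φ[i]` with `k < |w|`. [cite: TsitsiklisBlondel1997, §2 proof of Thm. 1, observation 2] -/
def SatisfiedBy (i : Fin φ.length) (w : List Bool) : Prop :=
  ∃ (k : ℕ) (hk : k < w.length), (k, w[k]) ∈ φ[i]

/-- `SatisfiedBy` is decidable (finite search). [folklore] -/
instance (i : Fin φ.length) (w : List Bool) : Decidable (SatisfiedBy φ i w) := by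
  unfold SatisfiedBy; infer_instance

/-- No clause is satisfied through zero variables. [folklore] -/
theorem not_satisfiedBy_nil (i : Fin φ.length) : ¬ SatisfiedBy φ i [] := by
  rintro ⟨k, hk, -⟩; simp at hk

/-- Reading one more variable: satisfied before, or through the new literal `(x_{|w|}, b)`. [folklore] -/
theorem satisfiedBy_append_singleton {i : Fin φ.length} {w : List Bool} {b : Bool} :
    SatisfiedBy φ i (w ++ [b]) ↔ SatisfiedBy φ i w ∨ (w.length, b) ∈ φ[i] := by
  constructor
  · rintro ⟨k, hk, hmem⟩
    rw [List.length_append, List.length_singleton] at hk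
    by_cases hk' : k < w.length
    · exact Or.inl ⟨k, hk', by rwa [List.getElem_append_left hk'] at hmem⟩
    · obtain rfl : k = w.length := by omega
      right
      simpa using hmem
  · rintro (⟨k, hk, hmem⟩ | hmem)
    · exact ⟨k, by simp; omega, by rwa [List.getElem_append_left hk]⟩
    · exact ⟨w.length, by simp, by simpa using hmem⟩

/-- A satisfied clause has read at least one variable. [folklore] -/
theorem SatisfiedBy.length_pos {i : Fin φ.length} {w : List Bool} (h : SatisfiedBy φ i w) :
    0 < w.length := by
  obtain ⟨k, hk, -⟩ := h; omega

section Walk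

variable {R : Type*} [Semiring R]

/-- **The walk of observation 2**: after reading the word `w` (`|w| ≤ n`) from `u i 0`, the walker
of clause `i` sits at `v (|w| - 1)` if the clause has been satisfied through one of the variables
read so far, and at `u i |w|` otherwise ("`A_{qₙ} ⋯ A_{q₁} x(u_{i1})` is equal to `x(u_{0n})` if the
clause `Cᵢ` is satisfied and is equal to `x(u_{i(n+1)})` otherwise").
[cite: TsitsiklisBlondel1997, §2 proof of Thm. 1, observation 2] -/
theorem wordProd_mulVec_single_u_zero (i : Fin φ.length) (w : List Bool) (hw : w.length ≤ φ.numVars) :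
    wordProd (tbMatrix φ R) w *ᵥ Pi.single (Node.u i 0) 1 =
      if h : SatisfiedBy φ i w then Pi.single (Node.v ⟨w.length - 1, by have := h.length_pos; omega⟩) 1
      else Pi.single (Node.u i ⟨w.length, by omega⟩) 1 := by
  induction w using List.reverseRecOn with
  | nil => rw [wordProd_nil, Matrix.one_mulVec, dif_neg (not_satisfiedBy_nil i)]; rfl
  | append_singleton w b ih =>
    have hw' : w.length < φ.numVars := by simpa using hw
    rw [wordProd_append_singleton_mulVec, ih hw'.le]
    by_cases h : SatisfiedBy φ i w
    · -- already on the `v`-row: move one step right (or stay claim)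
      have hsat : SatisfiedBy φ i (w ++ [b]) := satisfiedBy_append_singleton.2 (Or.inl h)
      have hpos := h.length_pos
      rw [dif_pos h, dif_pos hsat,
        tbMatrix_mulVec_single_of_next (by simp) (y := Node.v ⟨w.length, hw'⟩)]
      · congr 2; exact Fin.ext (by simp)
      · simp only [next]
        rw [dif_pos (show w.length - 1 + 1 < φ.numVars by omega)]
        congr 2
        exact Fin.ext (by simp only; omega)
    · rw [dif_neg h]
      by_cases hl : (w.length, b) ∈ φ[i]
      · have hsat : SatisfiedBy φ i (w ++ [b]) := satisfiedBy_append_singleton.2 (Or.inr hl)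
        have hl' : (w.length, b) ∈ φ[(i : ℕ)] := by simpa using hl
        rw [dif_pos hsat, tbMatrix_mulVec_single_of_next (by simp) (y := Node.v ⟨w.length, hw'⟩)]
        · congr 2; exact Fin.ext (by simp)
        · simp [next, hw', hl']
      · have hsat : ¬ SatisfiedBy φ i (w ++ [b]) := by
          rw [satisfiedBy_append_singleton]; push Not; exact ⟨h, hl⟩
        have hl' : (w.length, b) ∉ φ[(i : ℕ)] := by simpa using hl
        rw [dif_neg hsat,
          tbMatrix_mulVec_single_of_next (by simp) (y := Node.u i ⟨w.length + 1, by omega⟩)]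
        · congr 2; exact Fin.ext (by simp)
        · simp [next, hw', hl']

variable (φ) in
/-- The number `λ(w)` of clauses of `φ` satisfied by the word `w`.
[cite: TsitsiklisBlondel1997, §2 proof of Thm. 1, observation 2] -/
def numSatisfied (w : List Bool) : ℕ :=
  (Finset.univ.filter fun i : Fin φ.length ↦ SatisfiedBy φ i w).card

/-- **The cycle identity (observation 2)**: for a word `w` of length `n` and arbitrary letters
`a` (first) and `a'` (last), `A_{a'} A_{w_{n-1}} ⋯ A_{w_0} A_a e_s = λ(w) e_s`, `λ(w)` the number of
clauses satisfied by the truth assignment `xⱼ := wⱼ`.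
[cite: TsitsiklisBlondel1997, §2 proof of Thm. 1, observation 2] -/
theorem cycle_identity (w : List Bool) (hw : w.length = φ.numVars) (a a' : Bool) :
    wordProd (tbMatrix φ R) ([a] ++ w ++ [a']) *ᵥ Pi.single Node.s 1 =
      (numSatisfied φ w : R) • Pi.single Node.s 1 := by
  rw [wordProd_append_singleton_mulVec, wordProd_append, wordProd_singleton, ← mulVec_mulVec,
    tbMatrix_mulVec_single_s, mulVec_sum, mulVec_sum]
  have hstep : ∀ i : Fin φ.length,
      tbMatrix φ R a' *ᵥ (wordProd (tbMatrix φ R) w *ᵥ Pi.single (Node.u i 0) 1) =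
        if SatisfiedBy φ i w then Pi.single Node.s 1 else 0 := by
    intro i
    rw [wordProd_mulVec_single_u_zero i w hw.le]
    by_cases h : SatisfiedBy φ i w
    · rw [dif_pos h, if_pos h, tbMatrix_mulVec_single_of_next (by simp) (y := Node.s)]
      simp only [next]
      rw [dif_neg (by omega)]
    · rw [dif_neg h, if_neg h]
      have : (⟨w.length, by omega⟩ : Fin (φ.numVars + 1)) = Fin.last φ.numVars := Fin.ext (by simp [hw])
      rw [this, tbMatrix_mulVec_single_terminal]
  simp_rw [hstep]
  rw [Finset.sum_ite, Finset.sum_const_zero, add_zero, Finset.sum_const, numSatisfied,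
    Nat.cast_smul_eq_nsmul]

end Walk

/-! ### (3, SAT half) A satisfying assignment gives the eigenvalue `m` -/

/-- The word `(σ 0, …, σ (n-1))` of an assignment. [folklore] -/
def assignmentWord (φ : CNF ℕ) (σ : ℕ → Bool) : List Bool :=
  List.ofFn fun j : Fin φ.numVars ↦ σ j

/-- The word of an assignment has length `n`. [folklore] -/
@[simp] theorem length_assignmentWord (σ : ℕ → Bool) : (assignmentWord φ σ).length = φ.numVars := by
  simp [assignmentWord]

/-- A clause true under `σ` is satisfied by the word of `σ` (its variables are `< n`).
[cite: TsitsiklisBlondel1997, §2 proof of Thm. 1] -/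
theorem satisfiedBy_assignmentWord_of_eval {σ : ℕ → Bool} {i : Fin φ.length}
    (h : Clause.eval σ φ[i] = true) : SatisfiedBy φ i (assignmentWord φ σ) := by
  simp only [Clause.eval, List.any_eq_true, Literal.eval, beq_iff_eq] at h
  obtain ⟨⟨x, b⟩, hmem, hxb⟩ := h
  have hx : x < φ.numVars := CNF.lt_numVars_of_mem_of_mem (List.getElem_mem i.2) hmem
  refine ⟨x, by simpa, ?_⟩
  simpa [assignmentWord, hxb] using hmem

/-- All clauses are satisfied by the word of a satisfying assignment: `λ = m`.
[cite: TsitsiklisBlondel1997, §2 proof of Thm. 1] -/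
theorem numSatisfied_assignmentWord_of_eval {σ : ℕ → Bool} (h : φ.eval σ = true) :
    numSatisfied φ (assignmentWord φ σ) = φ.length := by
  rw [numSatisfied, Finset.filter_true_of_mem, Finset.card_univ, Fintype.card_fin]
  intro i _
  apply satisfiedBy_assignmentWord_of_eval
  simp only [CNF.eval, List.all_eq_true] at h
  exact h _ (List.getElem_mem i.2)

/-- **SAT ⇒ a product of `n + 2` factors with eigenvector `e_s` and eigenvalue `m`** ("Since all
`m` clauses are satisfied we have `A x(s) = m x(s)`", TB p. 36).
[cite: TsitsiklisBlondel1997, §2 proof of Thm. 1 (p. 36)] -/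
theorem cycle_identity_of_eval {R : Type*} [Semiring R] {σ : ℕ → Bool} (h : φ.eval σ = true)
    (a a' : Bool) :
    wordProd (tbMatrix φ R) ([a] ++ assignmentWord φ σ ++ [a']) *ᵥ Pi.single Node.s 1 =
      (φ.length : R) • Pi.single Node.s 1 := by
  rw [cycle_identity _ (length_assignmentWord σ), numSatisfied_assignmentWord_of_eval h]

/-- The word `[a] ++ w ++ [a']` has `n + 2` letters. [folklore] -/
theorem length_cycleWord (w : List Bool) (hw : w.length = φ.numVars) (a a' : Bool) :
    ([a] ++ w ++ [a']).length = φ.numVars + 2 := by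
  simp [hw]

end Literature.Dynamics.SwitchedSystems
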